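import Summits.QuantumFields.YangMills.Theorems.IR.Negative.TypShellCondUKPcFalseOfWildWire
import Summits.QuantumFields.YangMills.Theorems.IR.Negative.OnsetTypicalInert

/-!
# Crux `IR` (stmt-QuantumFields-19354), slot of record `af-pincer-Uc` (skeleton sha16 b6e69d9662b5b07a):
# EVERY TYPED KILL OF THE REGISTERED FORMAT T TRANSFERS TO FORMAT Uc (disprove-1 g5, Negative lane, part 2/2)

WHAT IS PROVED (sorry-free; axioms `propext`, `Classical.choice`, `Quot.sound`), against the mirrors of part 1
(`TypShellCondUKPcFalseOfWildWire`: `TypShellCondUKPc`, `OnsetMixingTypicalUKPc`): `typShellCond_of_UKPc` (Uc ⇒ the REGISTERED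
format T = tree mirror `OnsetFormats.TypShellCond`; slot :236 verbatim), `onsetMixingTypical_of_UKPc` (`stub_onsetUc` is
STRONGER than `stub_onsetT`); hence `not_onsetMixingTypicalUKPc_of_massWireSU2` (g3 mass wire, p500647),
`not_typShellCondUKPc_fixedMesh` (g4 fixed mesh, p510418) and `not_onsetMixingTypicalUKPcBdd` — **the `β`-UNIFORM-MESH
strengthening `OnsetMixingTypicalUKPcBdd` of `stub_onsetUc` is FALSE** (witness `SU(2)`, fundamental representation, centre
`−1`); `typShellCondUKPc_of_univShellCond` (`Typ ≡ univ`) and the inertness `forall_typShellCondUKPc_iff_univShellCond`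
(`∀ δ > 0`, format Uc IS the untempered format; via p503173).  The stub itself (`∃ b` AFTER `∀ β`: the mesh may grow with
`β`) is NOT refuted by any of these.

Elementary given the tree (Mathlib + landed Theorems∕Literature modules); no named facts as hypotheses; no `sorry`.
-/

set_option autoImplicit false

noncomputable section

open Filter Topology MeasureTheory
open Literature.MathematicalPhysics.QuantumFieldTheory Literature.MathematicalPhysics.QuantumLattice
open Literature.Probability.LatticeModels
open Summit.QuantumFields.YangMills.Cruxes.IR.Tempered (cellEdges windowCells regionEdges)
open Summit.QuantumFields.YangMills.Cruxes.IR.ShellTempered (windowCellsPlus)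
open Summit.QuantumFields.YangMills.Cruxes.IR.CellTempered.Engine (shiftFrame shiftFrame_mesh)
open Summit.QuantumFields.YangMills.Cruxes.IR.OnsetFormats (shellCount UnivShellCond TypShellCond OnsetMixingTypical
  MassWire not_onsetMixingTypical_of_massWireSU2)
open Summit.QuantumFields.YangMills.Cruxes.IR.OnsetFormatsInert (univShellCond_of_forall_typShellCond)
open Summit.QuantumFields.YangMills.Cruxes.IR.FixedMesh (not_typShellCond_fixedMesh
  OnsetMixingTypicalBdd not_onsetMixingTypicalBdd)

namespace Summit.QuantumFields.YangMills.Cruxes.IR.OnsetFormatsUc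

/-- The stub statement with a `β`-UNIFORM mesh bound `B = B(δ)` (the natural strengthening; cf. the landed
`FixedMesh.OnsetMixingTypicalBdd` for format T). -/
def OnsetMixingTypicalUKPcBdd : Prop :=
  ∀ (G : Type) [Group G] [TopologicalSpace G] [IsTopologicalGroup G] [CompactSpace G],
    IsCompactSimpleLieGroup G → letI : MeasurableSpace G := borel G; haveI : BorelSpace G := ⟨rfl⟩;
    ∀ r : LatticeRep G, ∃ (n : ℕ) (ε : ℝ), 1 ≤ n ∧ 0 ≤ ε ∧ ε * shellCount n ≤ 3 / 4 ∧
      ∀ δ : ℝ, 0 < δ → ∃ (B : ℕ) (β₂ : ℝ), ∀ β : ℝ, β₂ ≤ β →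
        ∃ b : ℕ, 1 ≤ b ∧ b ≤ B ∧ TypShellCondUKPc r.ρ β b n ε δ

/-! ## §1 Transfers: Uc ⇒ T (every typed kill of the registered format transfers), `univ`, inertness -/

section Transfer

variable {G : Type} [Group G] [TopologicalSpace G] [IsTopologicalGroup G] [CompactSpace G]
  [MeasurableSpace G] [BorelSpace G]

/-- **`TypShellCondUKPc ⇒` the REGISTERED `TypShellCond`** (slot :236 `typShellCond_of_UKPc` verbatim against the tree
mirrors): (i) at centre `0` is (i_T); UKP ⇒ (ii_T); (iii) identical. -/
theorem typShellCond_of_UKPc {N : ℕ} {ρ : G →* Matrix (Fin N) (Fin N) ℂ} {β : ℝ} {b n : ℕ} {ε δ : ℝ}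
    (hU : TypShellCondUKPc ρ β b n ε δ) : TypShellCond ρ β b n ε δ := by
  intro w hw
  obtain ⟨Typ, ⟨hm, hd⟩, hi, hii, hiii⟩ := hU w hw
  refine ⟨Typ, hm, hd, ?_, ?_, hiii⟩
  · have h := hi 0
    have hT : (fun c : Fin 4 → ℤ => Typ (c + 0)) = Typ := by funext c; rw [add_zero]
    rw [shiftFrame_zero, hT] at h
    exact h
  · intro F F' hFF' hF ζ hcollar
    refine hii F F' hFF' hF ζ ?_
    intro c hc c' hc'
    by_cases h : c' ∈ F'
    · exact Or.inl h
    · exact Or.inr (hcollar c' h ⟨c, hFF' hc, hc'⟩)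

/-- **Untempered mixing ⇒ format Uc at every `δ`** with the class `Typ ≡ univ`: (i) at every centre is the universal
clause at the shifted frame (`shiftFrame_mesh`), (ii) and (iii) charge the empty event. -/
theorem typShellCondUKPc_of_univShellCond {N : ℕ} {ρ : G →* Matrix (Fin N) (Fin N) ℂ} {β : ℝ} {b n : ℕ} {ε : ℝ}
    (hU : UnivShellCond ρ β b n ε) (δ : ℝ) : TypShellCondUKPc ρ β b n ε δ := by
  intro w hw
  refine ⟨fun _ => Set.univ, ⟨fun _ => MeasurableSet.univ, fun _ _ _ _ => rfl⟩, ?_, ?_, ?_⟩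
  · intro c₀ Y hY h0 σ σ' _ hagree f hf hfm hf01
    exact hU (shiftFrame w c₀) (shiftFrame_mesh hw c₀) Y hY h0 σ σ' hagree f hf hfm hf01
  · intro F F' _ hF ζ _
    obtain ⟨c, hc⟩ := hF
    have he : {σ : LGConfig 4 G | ∀ c ∈ F, σ ∉ (Set.univ : Set (LGConfig 4 G))} = ∅ :=
      Set.eq_empty_of_forall_notMem fun σ hσ => hσ c hc (Set.mem_univ σ)
    rw [he, measure_empty]
    exact zero_le
  · intro S _ F hF _
    obtain ⟨c, hc⟩ := hF
    have he : {V : GaugeConfig 4 (2 * S + 1) G |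
        ∀ c ∈ F, torusLift (2 * S + 1) V ∉ (Set.univ : Set (LGConfig 4 G))} = ∅ :=
      Set.eq_empty_of_forall_notMem fun V hV => hV c hc (Set.mem_univ _)
    rw [he, measure_empty]
    exact zero_le

/-- **Inertness of format Uc in `δ`**: `(∀ δ > 0, TypShellCondUKPc ρ β b n ε δ) ↔ UnivShellCond ρ β b n ε` (via the
landed inertness of format T, `OnsetFormatsInert.univShellCond_of_forall_typShellCond`). -/
theorem forall_typShellCondUKPc_iff_univShellCond [SecondCountableTopology G] {N : ℕ}
    {ρ : G →* Matrix (Fin N) (Fin N) ℂ} (hρ : Continuous ρ) {β : ℝ} {b n : ℕ} {ε : ℝ} :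
    (∀ δ : ℝ, 0 < δ → TypShellCondUKPc ρ β b n ε δ) ↔ UnivShellCond ρ β b n ε :=
  ⟨fun h => univShellCond_of_forall_typShellCond hρ fun δ hδ => typShellCond_of_UKPc (h δ hδ),
    fun hU δ _ => typShellCondUKPc_of_univShellCond hU δ⟩

/-- **The fixed-mesh negative transfers to Uc** (g4 `FixedMesh.not_typShellCond_fixedMesh`, p510418): compact `G`,
continuous faithful unitary `ρ` of degree `N ≥ 1` with a central `g₀`, `ρ g₀ = c • 1`, `c ≠ 1`; mesh `b ≥ 1`; budgets
`0 ≤ ε`, `16 ε < ‖1 − c‖`, `0 ≤ δ`, `4·#windowCellsPlus(n)·δ < 1`: format Uc fails for all large `β`. -/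
theorem not_typShellCondUKPc_fixedMesh [SecondCountableTopology G] {N : ℕ} (ρ : G →* Matrix (Fin N) (Fin N) ℂ)
    (hρ : Continuous ρ) (hρi : Function.Injective ρ) (hρu : ∀ g, ρ g ∈ Matrix.unitaryGroup (Fin N) ℂ) (hN : 1 ≤ N)
    {g₀ : G} (hg : g₀ ∈ Subgroup.center G) {c : ℂ} (hρc : ρ g₀ = c • (1 : Matrix (Fin N) (Fin N) ℂ))
    (hc : c ≠ 1) {b : ℕ} (hb : 1 ≤ b) (n : ℕ) {ε δ : ℝ} (hε0 : 0 ≤ ε) (hε : 16 * ε < ‖1 - c‖)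
    (hδ0 : 0 ≤ δ) (hδ : 4 * ((windowCellsPlus n).card : ℝ) * δ < 1) :
    ∃ β₀ : ℝ, ∀ β : ℝ, β₀ ≤ β → ¬ TypShellCondUKPc ρ β b n ε δ := by
  obtain ⟨β₀, h⟩ := not_typShellCond_fixedMesh ρ hρ hρi hρu hN hg hρc hc hb n hε0 hε hδ0 hδ
  exact ⟨β₀, fun β hβ hU => h β hβ (typShellCond_of_UKPc hU)⟩

end Transfer

/-- **I^{Uc} ⇒ the registered I_T** (`stub_onsetUc` is STRONGER than `stub_onsetT`; slot `onsetMixingTypical_of_UKPc`). -/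
theorem onsetMixingTypical_of_UKPc (h : OnsetMixingTypicalUKPc) : OnsetMixingTypical := by
  intro G _ _ _ _ hG
  letI : MeasurableSpace G := borel G
  haveI : BorelSpace G := ⟨rfl⟩
  intro r
  obtain ⟨n, ε, hn, hε, hM, hδ⟩ := h G hG r
  refine ⟨n, ε, hn, hε, by linarith, fun δ hδ0 => ?_⟩
  obtain ⟨β₂, hβ⟩ := hδ δ hδ0
  refine ⟨β₂, fun β hβ' => ?_⟩
  obtain ⟨b, hb, hT⟩ := hβ β hβ'
  exact ⟨b, hb, typShellCond_of_UKPc hT⟩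

/-- Every refutation of the registered `stub_onsetT` statement refutes `stub_onsetUc`'s. -/
theorem not_onsetMixingTypicalUKPc_of_not_onsetMixingTypical (h : ¬ OnsetMixingTypical) :
    ¬ OnsetMixingTypicalUKPc :=
  fun hU => h (onsetMixingTypical_of_UKPc hU)

/-- **g3's mass wire transfers**: a mass wire for one lattice representation of `SU(2)` refutes `stub_onsetUc`'s
statement (`OnsetFormats.not_onsetMixingTypical_of_massWireSU2`, p500647). -/
theorem not_onsetMixingTypicalUKPc_of_massWireSU2
    (hW : letI : MeasurableSpace (Matrix.specialUnitaryGroup (Fin 2) ℂ) :=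
        borel (Matrix.specialUnitaryGroup (Fin 2) ℂ);
      haveI : BorelSpace (Matrix.specialUnitaryGroup (Fin 2) ℂ) := ⟨rfl⟩;
      ∃ r : LatticeRep (Matrix.specialUnitaryGroup (Fin 2) ℂ), MassWire r.ρ) : ¬ OnsetMixingTypicalUKPc :=
  not_onsetMixingTypicalUKPc_of_not_onsetMixingTypical (not_onsetMixingTypical_of_massWireSU2 hW)

/-- The bounded-mesh form implies the stub statement. -/
theorem onsetMixingTypicalUKPc_of_bdd (h : OnsetMixingTypicalUKPcBdd) : OnsetMixingTypicalUKPc := by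
  intro G _ _ _ _ hG
  letI : MeasurableSpace G := borel G
  haveI : BorelSpace G := ⟨rfl⟩
  intro r
  obtain ⟨n, ε, hn, hε, hM, hB⟩ := h G hG r
  refine ⟨n, ε, hn, hε, hM, fun δ hδ => ?_⟩
  obtain ⟨B, β₂, hβ₂⟩ := hB δ hδ
  refine ⟨β₂, fun β hβ => ?_⟩
  obtain ⟨b, hb, -, hT⟩ := hβ₂ β hβ
  exact ⟨b, hb, hT⟩

/-- The bounded-mesh form of `stub_onsetUc` implies the bounded-mesh form of `stub_onsetT`. -/
theorem onsetMixingTypicalBdd_of_UKPcBdd (h : OnsetMixingTypicalUKPcBdd) : OnsetMixingTypicalBdd := by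
  intro G _ _ _ _ hG
  letI : MeasurableSpace G := borel G
  haveI : BorelSpace G := ⟨rfl⟩
  intro r
  obtain ⟨n, ε, hn, hε, hM, hB⟩ := h G hG r
  refine ⟨n, ε, hn, hε, by linarith, fun δ hδ => ?_⟩
  obtain ⟨B, β₂, hβ₂⟩ := hB δ hδ
  refine ⟨B, β₂, fun β hβ => ?_⟩
  obtain ⟨b, hb, hbB, hT⟩ := hβ₂ β hβ
  exact ⟨b, hb, hbB, typShellCond_of_UKPc hT⟩

/-- **The `β`-uniform-mesh strengthening of `stub_onsetUc` is FALSE** (witness `SU(2)`, fundamental representation,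
centre `−1`: g4's `FixedMesh.not_onsetMixingTypicalBdd`).  The stub itself (`∃ b` after `∀ β`) is NOT refuted. -/
theorem not_onsetMixingTypicalUKPcBdd : ¬ OnsetMixingTypicalUKPcBdd :=
  fun h => not_onsetMixingTypicalBdd (onsetMixingTypicalBdd_of_UKPcBdd h)

end Summit.QuantumFields.YangMills.Cruxes.IR.OnsetFormatsUc

end
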